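import Mathlib
import HarnessLib
import Literature.RingTheory.TightClosure.TightClosure

/-!
# Pigeonhole for Frobenius bracket powers (crux `FrobeniusLadder.FInjectiveMacaulayfication`, line `Sketch`)

Stub `stub_pigeonhole` of the skeleton `Sketch` for crux stmt-ResolutionOfSingularities-15315.
For an ideal `𝔞 = (g₀, …, g_{ν-1})` of a commutative ring `R` generated by `ν` elements and a prime `p`,
`𝔞 ^ (p n + (ν - 1) (p - 1)) ≤ (𝔞 ^ n)^[p]`, where `I^[p] = frobeniusPower p I` is the ideal generated
by the `p`-th powers of the elements of `I` (no characteristic hypothesis is needed; of `p.Prime` only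
`0 < p` is used).

Classical proof: a monomial `g^α` of degree `p n + (ν-1)(p-1)` in the `ν` generators has `α = p β + r`
with `0 ≤ rᵢ ≤ p - 1`, hence `|β| ≥ n` and `g^α = (g^β)^p · g^r ∈ (𝔞ⁿ)^[p]`. The formal proof avoids
multinomial bookkeeping: induction on `ν`, splitting `𝔞 = (g₀) ⊔ (g₁, …)` (`Fin.range_fin_succ`,
`Ideal.span_insert`) and expanding `(I ⊔ J)^N` by the binomial theorem in the commutative semiring
`Ideal R` (as in Mathlib's `Ideal.sup_pow_add_le_pow_sup_pow`). The principal case is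
`(a)^(p m) = ((a^m)^p) ≤ ((a)^m)^[p]` (`span_singleton_pow_mul_le`), the two pieces are recombined by
`I^[p] * J^[p] ≤ (I * J)^[p]` (`frobeniusPower_mul_le`), and the pigeonhole is the exponent split
`i = p a + r`, `r ≤ p - 1`, in `sup_pow_le_frobeniusPower`.
-/

-- single-problem summit: the doubled namespace component is forced
set_option linter.dupNamespace false

namespace Summit.ResolutionOfSingularities.ResolutionOfSingularities.Theorems.FInjectiveMacaulayfication

open Literature.RingTheory.TightClosure

/-- `I^[q] * J^[q] ≤ (I * J)^[q]`: on generators, `x^q * y^q = (x y)^q` with `x y ∈ I J`. -/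
theorem frobeniusPower_mul_le {R : Type*} [CommRing R] (q : ℕ) (I J : Ideal R) :
    frobeniusPower q I * frobeniusPower q J ≤ frobeniusPower q (I * J) := by
  rw [frobeniusPower_def q I, frobeniusPower_def q J, Ideal.span_mul_span']
  refine Ideal.span_le.mpr ?_
  rintro _ ⟨_, ⟨x, hx, rfl⟩, _, ⟨y, hy, rfl⟩, rfl⟩
  show x ^ q * y ^ q ∈ frobeniusPower q (I * J)
  rw [← mul_pow]
  exact pow_mem_frobeniusPower (Ideal.mul_mem_mul hx hy)

/-- Principal case of the pigeonhole: `(a)^(q m) ≤ ((a)^m)^[q]`, since `a^(q m) = (a^m)^q`. -/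
theorem span_singleton_pow_mul_le {R : Type*} [CommRing R] (q m : ℕ) (a : R) :
    Ideal.span {a} ^ (q * m) ≤ frobeniusPower q (Ideal.span {a} ^ m) := by
  rw [Ideal.span_singleton_pow, Ideal.span_singleton_pow, Ideal.span_singleton_le_iff_mem, pow_mul']
  exact pow_mem_frobeniusPower (Ideal.mem_span_singleton_self _)

/-- The inductive step of the pigeonhole. If `I^(p m) ≤ (I^m)^[p]` and `J^(p m + c (p-1)) ≤ (J^m)^[p]`
for all `m`, then `(I ⊔ J)^(p n + (c+1)(p-1)) ≤ ((I ⊔ J)^n)^[p]`: expand `(I + J)^N` binomially in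
`Ideal R`; for the term `I^i J^(N-i)` write `i = p a + r` with `r ≤ p - 1`; if `n ≤ a` then
`I^i ≤ I^(p a) ≤ (I^a)^[p] ≤ ((I ⊔ J)^n)^[p]`, else `N - i ≥ p (n-a) + c (p-1)` and
`I^i J^(N-i) ≤ (I^a)^[p] (J^(n-a))^[p] ≤ (I^a J^(n-a))^[p] ≤ ((I ⊔ J)^n)^[p]`. -/
theorem sup_pow_le_frobeniusPower {R : Type*} [CommRing R] {p : ℕ} (hp : 0 < p) (c : ℕ)
    {I J : Ideal R} (hI : ∀ m : ℕ, I ^ (p * m) ≤ frobeniusPower p (I ^ m))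
    (hJ : ∀ m : ℕ, J ^ (p * m + c * (p - 1)) ≤ frobeniusPower p (J ^ m)) (n : ℕ) :
    (I ⊔ J) ^ (p * n + (c + 1) * (p - 1)) ≤ frobeniusPower p ((I ⊔ J) ^ n) := by
  obtain ⟨K, hK⟩ : ∃ K : Ideal R, K = I ⊔ J := ⟨_, rfl⟩
  have hIK : I ≤ K := hK ▸ le_sup_left
  have hJK : J ≤ K := hK ▸ le_sup_right
  suffices h : (I ⊔ J) ^ (p * n + (c + 1) * (p - 1)) ≤ frobeniusPower p (K ^ n) by rwa [hK] at h
  generalize hN : p * n + (c + 1) * (p - 1) = N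
  rw [← Ideal.add_eq_sup, add_pow, Ideal.sum_eq_sup]
  refine Finset.sup_le fun i _ => Ideal.mul_le_right.trans ?_
  -- the term `I ^ i * J ^ (N - i)`; pigeonhole on `i = p a + r`, `r < p`
  obtain ⟨a, r, hr, rfl⟩ : ∃ a r : ℕ, r < p ∧ i = p * a + r :=
    ⟨i / p, i % p, Nat.mod_lt i hp, (Nat.div_add_mod i p).symm⟩
  rcases le_or_gt n a with han | han
  · calc I ^ (p * a + r) * J ^ (N - (p * a + r)) ≤ I ^ (p * a + r) := Ideal.mul_le_right
      _ ≤ I ^ (p * a) := Ideal.pow_le_pow_right (Nat.le_add_right _ _)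
      _ ≤ frobeniusPower p (I ^ a) := hI a
      _ ≤ frobeniusPower p (K ^ n) :=
        frobeniusPower_mono p ((Ideal.pow_le_pow_right han).trans (Ideal.pow_right_mono hIK n))
  · have h1 : p * (n - a) = p * n - p * a := Nat.mul_sub p n a
    have h2 : p * a ≤ p * n := Nat.mul_le_mul_left p han.le
    have h3 : (c + 1) * (p - 1) = c * (p - 1) + (p - 1) := Nat.succ_mul c (p - 1)
    have hle : p * (n - a) + c * (p - 1) ≤ N - (p * a + r) := by omega
    calc I ^ (p * a + r) * J ^ (N - (p * a + r))
        ≤ I ^ (p * a) * J ^ (p * (n - a) + c * (p - 1)) :=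
          Ideal.mul_mono (Ideal.pow_le_pow_right (Nat.le_add_right _ _)) (Ideal.pow_le_pow_right hle)
      _ ≤ frobeniusPower p (I ^ a) * frobeniusPower p (J ^ (n - a)) :=
          Ideal.mul_mono (hI a) (hJ (n - a))
      _ ≤ frobeniusPower p (I ^ a * J ^ (n - a)) := frobeniusPower_mul_le p _ _
      _ ≤ frobeniusPower p (K ^ n) := by
          refine frobeniusPower_mono p ?_
          calc I ^ a * J ^ (n - a) ≤ K ^ a * K ^ (n - a) :=
                Ideal.mul_mono (Ideal.pow_right_mono hIK a) (Ideal.pow_right_mono hJK _)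
            _ = K ^ n := by rw [← pow_add, Nat.add_sub_of_le han.le]

/-- PIGEONHOLE (cards `graded-cartier-criterion` / `weakly-normal-centres`, Sketch `stub_pigeonhole`): for an
ideal `𝔞` generated by `ν` elements, `𝔞^{pn+(ν-1)(p-1)} ⊆ (𝔞ⁿ)^{[p]}` (a monomial of degree
`pn+(ν-1)(p-1)` in `ν` generators is `g^{pβ+r}` with `0 ≤ rᵢ ≤ p-1`, hence `|β| ≥ n`). Proof by induction
on `ν`: `ν = 0` and `ν = 1` are the principal case `span_singleton_pow_mul_le` (with `𝔞 = (0)`, resp.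
`𝔞 = (g 0)`), and `ν = μ + 2` is `sup_pow_le_frobeniusPower` applied to `(g 0) ⊔ (g 1, …, g (μ+1))`. -/
theorem stub_pigeonhole : ∀ {R : Type} [CommRing R] (p : ℕ), p.Prime → ∀ {ν : ℕ} (g : Fin ν → R) (n : ℕ),
    Ideal.span (Set.range g) ^ (p * n + (ν - 1) * (p - 1)) ≤
      Literature.RingTheory.TightClosure.frobeniusPower p (Ideal.span (Set.range g) ^ n) := by
  intro R _ p hp ν
  cases ν with
  | zero =>
    intro g n
    rw [Set.range_eq_empty g, Ideal.span_empty, ← Ideal.span_singleton_zero, Nat.zero_sub, zero_mul,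
      add_zero]
    exact span_singleton_pow_mul_le p n 0
  | succ μ =>
    rw [Nat.add_sub_cancel]
    induction μ with
    | zero =>
      intro g n
      rw [Fin.range_fin_succ, Set.range_eq_empty, Ideal.span_insert, Ideal.span_empty, sup_bot_eq,
        zero_mul, add_zero]
      exact span_singleton_pow_mul_le p n (g 0)
    | succ μ ih =>
      intro g n
      rw [Fin.range_fin_succ, Ideal.span_insert]
      exact sup_pow_le_frobeniusPower hp.pos μ (fun m => span_singleton_pow_mul_le p m (g 0))
        (fun m => ih (Fin.tail g) m) n

end Summit.ResolutionOfSingularities.ResolutionOfSingularities.Theorems.FInjectiveMacaulayfication
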